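import Literature.NumberTheory.NumberFields.RayClassFieldAdicCharacter
import Literature.NumberTheory.EllipticCurves.ProfiniteGroupDistributionCharacterCellsIndex
import HarnessLib

/-!
# The `v`-ray class towers `U_n = Gal(K̄/K(𝔪'v^{n+1}))` inside `Gal(K̄/K(𝔪))` and the character read
# in `ℤ_pˣ`: the measure side's `hU` and `hκ` VERBATIM (de Shalit 1987, II.1.9 / I.3.3 (9); part 3 of 3)

Sequel of `RayClassFieldAdicArtinValue.lean` and `RayClassFieldAdicCharacter.lean` (the `v`-adic Artin
character `κ = rayAdicCharacter h𝔪 hv hw : Gal(K̄/K(𝔪)) →* 𝒪_vˣ`, its `hU` in valuation currency and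
its surjectivity). THIS FILE delivers the inputs of `ProfiniteGroupDistributionCharacterCells.lean`
(`SubgroupTower.cellMap_trans/_injective/_fiberSurj`, `GroupDistribution.comap_family_equivariant_of_character`,
`integral_comap_of_character`) and of the series families (`PAdicOneVariableSeriesFamilyOfCharacter.lean`
etc.) in THEIR currency — a `SubgroupTower` of a group `G`, a character `κ : G →* ℤ_pˣ`, `hU`, `hκ`:

* §4 reading `𝒪_v` in `ℤ_p` along a ring isomorphism `e : 𝒪_v ≃+* ℤ_p` (degree-one unramified `v`,
  de Shalit's `𝒪_𝔭 = ℤ_p` at a split prime): `valued_symm_natCast_eq_exp_neg_one` (`e⁻¹ p` is a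
  uniformizer), `toZModPow_map_eq_zero_iff_valued`, `toZModPow_map_eq_one_iff_valued`
  (`e u ≡ 1 mod pⁿ ↔ |u − 1|_v ≤ |vⁿ|`).
* §5 ★★★ `rayAdicTower h𝔪' v : SubgroupTower Gal(K̄/K(𝔪))` for every `0 ≠ 𝔪' ⊆ 𝔪`
  (`U_n = Gal(K̄/K(𝔪'v^{n+1}))`; normal open finite-index levels — ALL the one-variable towers of de
  Shalit's II.4.14 Step 1 inside ONE group `G = Gal(K̄/K(𝔪))`), and for `κ_p = e ∘ κ : G →* ℤ_pˣ`:
  `mem_rayAdicTower_iff` (= **`hU` VERBATIM**: `σ ∈ U_n ↔ σ ∈ U_0 ∧ κ_p σ ≡ 1 mod p^{n+1}`),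
  `exists_toZModPow_padicRayAdicCharacter_eq` (= **`hκ` VERBATIM**), and the strong form
  `padicRayAdicCharacter_surjective` (`κ_p` onto `ℤ_pˣ`).

One definition with body (`rayAdicTower`); theorems otherwise; no named facts, no instances, no
`sorry`. What is NOT here (for the consumer): the ring isomorphism `e : 𝒪_v ≃+* ℤ_p` itself for a
degree-one unramified `v` of a general number field (the tree has it over `ℚ`,
`Rat.HeightOneSpectrum.adicCompletionIntegers.padicIntEquiv`), and the dictionary «Artin symbol of a
principal ideal `(α)`, `α ≡ 1 mod 𝔪` ↦ `κ = α_v⁻¹`» for the division data of II.4.12.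

## References

* [deShalit1987] E. de Shalit, *Iwasawa theory of elliptic curves with complex multiplication*
  (1987), I.3.1 (p. 16), I.3.3 (9) (p. 17–18), II.1.1 (p. 32), II.1.9 (p. 43), II.4.4–4.6 (p. 57–59),
  II.4.12 Remark (i) (p. 67), II.4.14 Step 1 (p. 71).
* [CasselsFrohlichANT1967] J.-P. Serre, *Local class field theory*, Ch. VI of Cassels–Fröhlich (1967),
  §3.6 Prop. 6 (b) (the principal units read in `ℤ_p`).
* [NeukirchANT1999] J. Neukirch, *Algebraic Number Theory* (1999), Ch. II §4, Ch. VI §6 (6.2).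
-/

noncomputable section

open NumberField IsDedekindDomain IsDedekindDomain.HeightOneSpectrum Field
open scoped nonZeroDivisors Classical

namespace Literature.NumberTheory.NumberFields

open Literature.NumberTheory.GaloisRepresentations
open Literature.NumberTheory.EllipticCurves (SubgroupTower)

variable {K : Type} [Field K] [NumberField K]

/-! ### §4. Reading `𝒪_v` in `ℤ_p` along a ring isomorphism `e : 𝒪_v ≃+* ℤ_p` -/

section Padic

variable {v : HeightOneSpectrum (𝓞 K)} {p : ℕ} [Fact p.Prime] (e : v.adicCompletionIntegers K ≃+* ℤ_[p])

/-- `𝒪_v → K_v` is the inclusion. [cite: NeukirchANT1999, Ch. II §4 (p. 124)] -/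
theorem algebraMap_adicCompletionIntegers_apply (x : v.adicCompletionIntegers K) :
    algebraMap (v.adicCompletionIntegers K) (v.adicCompletion K) x = (x : v.adicCompletion K) := rfl

/-- Along a ring isomorphism `𝒪_v ≅ ℤ_p` (degree-one unramified `v`: de Shalit's `𝒪_𝔭 = ℤ_p` at a split
prime), the pull-back `e⁻¹(p)` of `p` is a uniformizer of `𝒪_v`: `|e⁻¹ p|_v = |v|` — it is
irreducible (as `p ∈ ℤ_p` is), hence an associate of any uniformizer.
[cite: deShalit1987, I.3.3 (p. 17), II.1.1 (p. 32)] -/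
theorem valued_symm_natCast_eq_exp_neg_one :
    Valued.v ((e.symm (p : ℤ_[p]) : v.adicCompletionIntegers K) : v.adicCompletion K) =
      WithZero.exp (-1 : ℤ) := by
  have hI := HeightOneSpectrum.adicCompletionIntegers.integers K v
  have hirr : Irreducible (e.symm (p : ℤ_[p])) :=
    (MulEquiv.irreducible_iff e.symm.toMulEquiv).mpr PadicInt.irreducible_p
  -- a uniformizer `ϖ ∈ 𝒪_v` with `|ϖ| = exp (-1)` (from a global one)
  obtain ⟨π, hπ⟩ := v.valuation_exists_uniformizer K
  have hπv : Valued.v (π : v.adicCompletion K) = WithZero.exp (-1 : ℤ) := by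
    rw [valuedAdicCompletion_eq_valuation', hπ]
  have hπmem : (π : v.adicCompletion K) ∈ v.adicCompletionIntegers K := by
    rw [mem_adicCompletionIntegers, hπv, ← WithZero.exp_zero, WithZero.exp_le_exp]; norm_num
  set ϖ : v.adicCompletionIntegers K := ⟨(π : v.adicCompletion K), hπmem⟩ with hϖ
  have hϖv : Valued.v ((ϖ : v.adicCompletionIntegers K) : v.adicCompletion K) = WithZero.exp (-1 : ℤ) := by
    rw [hϖ]; exact hπv
  -- `|e⁻¹ p| < 1 = exp 0`, so `|e⁻¹ p| ≤ exp (-1) = |ϖ|`, so `ϖ ∣ e⁻¹ p`; irreducibility forces a unit quotient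
  have hlt := hI.valuation_irreducible_lt_one hirr
  rw [algebraMap_adicCompletionIntegers_apply] at hlt
  have hne : Valued.v ((e.symm (p : ℤ_[p]) : v.adicCompletionIntegers K) : v.adicCompletion K) ≠ 0 := by
    rw [Valuation.ne_zero_iff]
    intro h
    apply hirr.ne_zero
    exact_mod_cast h
  have hle : Valued.v (algebraMap _ (v.adicCompletion K) (e.symm (p : ℤ_[p]))) ≤
      Valued.v (algebraMap _ (v.adicCompletion K) ϖ) := by
    rw [algebraMap_adicCompletionIntegers_apply, algebraMap_adicCompletionIntegers_apply, hϖv,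
      ← WithZero.exp_log hne, WithZero.exp_le_exp]
    rw [← WithZero.exp_log hne, ← WithZero.exp_zero, WithZero.exp_lt_exp] at hlt
    omega
  obtain ⟨d, hd⟩ := hI.dvd_of_le hle
  rcases hirr.isUnit_or_isUnit hd with hu | hu
  · have h1 := hI.one_of_isUnit hu
    rw [algebraMap_adicCompletionIntegers_apply, hϖv, ← WithZero.exp_zero, WithZero.exp_inj] at h1
    omega
  · have h1 := hI.one_of_isUnit hu
    rw [algebraMap_adicCompletionIntegers_apply] at h1
    rw [hd, MulMemClass.coe_mul, map_mul, h1, mul_one, hϖv]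

/-- **`e x ≡ 0 mod pⁿ ↔ |x|_v ≤ |vⁿ|`**: the congruences of `𝒪_v` read in `ℤ_p`.
[cite: deShalit1987, II.1.9 (p. 43)] -/
theorem toZModPow_map_eq_zero_iff_valued (n : ℕ) (x : v.adicCompletionIntegers K) :
    PadicInt.toZModPow n (e x) = 0 ↔
      Valued.v ((x : v.adicCompletionIntegers K) : v.adicCompletion K) ≤ WithZero.exp (-(n : ℤ)) := by
  have hI := HeightOneSpectrum.adicCompletionIntegers.integers K v
  rw [← RingHom.mem_ker, PadicInt.ker_toZModPow, Ideal.mem_span_singleton]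
  have hdvd : (p : ℤ_[p]) ^ n ∣ e x ↔ e.symm (p : ℤ_[p]) ^ n ∣ x := by
    constructor
    · intro h; simpa using map_dvd e.symm h
    · intro h; simpa using map_dvd e h
  rw [hdvd, hI.dvd_iff_le, algebraMap_adicCompletionIntegers_apply, algebraMap_adicCompletionIntegers_apply,
    SubmonoidClass.coe_pow, map_pow, valued_symm_natCast_eq_exp_neg_one e, ← WithZero.exp_nsmul]
  simp

/-- **`e u ≡ 1 mod pⁿ ↔ |u − 1|_v ≤ |vⁿ|`** for `u ∈ 𝒪_v` (the principal units of level `n` read in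
`ℤ_p`: `1 + vⁿ𝒪_v ↔ 1 + pⁿℤ_p`). [cite: deShalit1987, II.1.9 (p. 43)] -/
theorem toZModPow_map_eq_one_iff_valued (n : ℕ) (u : v.adicCompletionIntegers K) :
    PadicInt.toZModPow n (e u) = 1 ↔
      Valued.v ((u : v.adicCompletion K) - 1) ≤ WithZero.exp (-(n : ℤ)) := by
  rw [← sub_eq_zero, ← map_one (PadicInt.toZModPow n), ← map_sub, ← map_one e, ← map_sub,
    toZModPow_map_eq_zero_iff_valued e n, AddSubgroupClass.coe_sub, OneMemClass.coe_one]

end Padic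

/-! ### §5. The packaged towers `U_n = Gal(K̄/K(𝔪'v^{n+1}))`, `𝔪 ∣ 𝔪'`, inside `Gal(K̄/K(𝔪))`, with `hU`, `hκ` VERBATIM -/

section Tower

variable {𝔪 𝔪' : Ideal (𝓞 K)} (h𝔪' : 𝔪' ≠ ⊥) (v : HeightOneSpectrum (𝓞 K))

/-- **The `v`-ray class tower of modulus `𝔪'` above `K(𝔪)`** (`0 ≠ 𝔪' ⊆ 𝔪`):
`U_n = Gal(K̄/K(𝔪'v^{n+1}))` as finite-index subgroups of `G = Gal(K̄/K(𝔪))` — de Shalit's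
`G_n = Gal(F_∞/F_n)`, `F_n = K(𝔣𝔭^n)` with `𝔣 = 𝔪'` running over the multiples of a fixed `𝔪`
(the moduli `𝔣 = 𝔤𝔭̄^m` of II.4.14 Step 1 all inside ONE group), in the `SubgroupTower` currency of
the measure side. [cite: deShalit1987, II.4.4 (p. 57), II.4.6 (p. 59), II.4.14 Step 1 (p. 71)] -/
def rayAdicTower : SubgroupTower ↥(absRestrictNormalHom (rayClassField K 𝔪)).ker where
  U n := ((absRestrictNormalHom (rayClassField K (𝔪' * v.asIdeal ^ (n + 1)))).ker).subgroupOf _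
  finiteIndex n := by
    haveI : ((absRestrictNormalHom (rayClassField K (𝔪' * v.asIdeal ^ (n + 1)))).ker).FiniteIndex := by
      haveI := Subgroup.quotient_finite_of_isOpen _
        (isOpen_ker_absRestrictNormalHom (rayClassField K (𝔪' * v.asIdeal ^ (n + 1))))
      exact Subgroup.finiteIndex_of_finite_quotient
    infer_instance
  succ_le n := fun σ hσ ↦ Subgroup.mem_subgroupOf.mpr
    (ker_absRestrictNormalHom_anti_of_le (rayClassField_mul_pow_succ_le_succ v h𝔪' n)
      (Subgroup.mem_subgroupOf.mp hσ))

/-- The levels of the tower. [cite: deShalit1987, II.4.4 (p. 57)] -/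
theorem mem_rayAdicTower_U_iff (n : ℕ) (σ : ↥(absRestrictNormalHom (rayClassField K 𝔪)).ker) :
    σ ∈ (rayAdicTower (𝔪 := 𝔪) h𝔪' v).U n ↔
      (σ : absoluteGaloisGroup K) ∈ (absRestrictNormalHom (rayClassField K (𝔪' * v.asIdeal ^ (n + 1)))).ker :=
  Subgroup.mem_subgroupOf

/-- The levels of the tower are normal (the towers of the measure side carry convolution).
[cite: deShalit1987, I.3.1 (p. 16)] -/
theorem rayAdicTower_U_normal (n : ℕ) : ((rayAdicTower (𝔪 := 𝔪) h𝔪' v).U n).Normal := by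
  change (((absRestrictNormalHom (rayClassField K (𝔪' * v.asIdeal ^ (n + 1)))).ker).subgroupOf _).Normal
  infer_instance

/-- The levels of the tower are open. [cite: deShalit1987, II.4.12 Remark (i) (p. 67)] -/
theorem isOpen_rayAdicTower_U (n : ℕ) :
    IsOpen ((rayAdicTower (𝔪 := 𝔪) h𝔪' v).U n : Set ↥(absRestrictNormalHom (rayClassField K 𝔪)).ker) :=
  (isOpen_ker_absRestrictNormalHom (rayClassField K (𝔪' * v.asIdeal ^ (n + 1)))).preimage
    continuous_subtype_val

/-- A member of some level lies in `Gal(K̄/K(𝔪'))`. [cite: deShalit1987, II.4.4 (p. 57)] -/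
theorem mem_ker_of_mem_rayAdicTower_U {n : ℕ} {σ : ↥(absRestrictNormalHom (rayClassField K 𝔪)).ker}
    (hσ : σ ∈ (rayAdicTower (𝔪 := 𝔪) h𝔪' v).U n) :
    (σ : absoluteGaloisGroup K) ∈ (absRestrictNormalHom (rayClassField K 𝔪')).ker :=
  ker_absRestrictNormalHom_anti_of_le
    (rayClassField_le_of_le (mul_ne_zero h𝔪' (pow_ne_zero _ v.ne_bot)) Ideal.mul_le_right)
    ((mem_rayAdicTower_U_iff h𝔪' v n σ).mp hσ)

variable [IsTotallyComplex K] {v} (h𝔪 : 𝔪 ≠ ⊥) (hv : ¬ 𝔪 ≤ v.asIdeal)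
  (hw : ∀ u : (𝓞 K)ˣ, (u : 𝓞 K) - 1 ∈ 𝔪 → u = 1)

/-- `σ ∈ U_n ↔ |κ'σ − 1|_v ≤ |v^{n+1}|` with the character `κ'` ABOVE `𝔪'`, for `σ ∈ Gal(K̄/K(𝔪'))`.
[cite: deShalit1987, II.1.9 (p. 43), II.4.6 (p. 59)] -/
theorem mem_rayAdicTower_iff_valued' (hle : 𝔪' ≤ 𝔪) (hv' : ¬ 𝔪' ≤ v.asIdeal) (n : ℕ)
    (σ : ↥(absRestrictNormalHom (rayClassField K 𝔪)).ker)
    (hσ : (σ : absoluteGaloisGroup K) ∈ (absRestrictNormalHom (rayClassField K 𝔪')).ker) :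
    σ ∈ (rayAdicTower (𝔪 := 𝔪) h𝔪' v).U n ↔
      Valued.v ((((rayAdicCharacter h𝔪' hv' (units_eq_one_of_sub_one_mem_of_le hle hw) ⟨σ, hσ⟩ :
        (v.adicCompletionIntegers K)ˣ) : v.adicCompletionIntegers K) : v.adicCompletion K) - 1) ≤
          WithZero.exp (-((n + 1 : ℕ) : ℤ)) := by
  rw [mem_rayAdicTower_U_iff, ← mem_ker_rayClassField_mul_pow_iff_valued h𝔪' hv'
    (units_eq_one_of_sub_one_mem_of_le hle hw) ⟨σ, hσ⟩ (n + 1)]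

/-- **`σ ∈ U_n ↔ σ ∈ Gal(K̄/K(𝔪')) ∧ |κσ − 1|_v ≤ |v^{n+1}|`** with the ONE character `κ` above `𝔪`
(compatibility `rayAdicCharacter_eq_of_le`). [cite: deShalit1987, II.1.9 (p. 43), II.4.6 (p. 59), II.4.14 Step 1 (p. 71)] -/
theorem mem_rayAdicTower_iff_valued (hle : 𝔪' ≤ 𝔪) (hv' : ¬ 𝔪' ≤ v.asIdeal) (n : ℕ)
    (σ : ↥(absRestrictNormalHom (rayClassField K 𝔪)).ker) :
    σ ∈ (rayAdicTower (𝔪 := 𝔪) h𝔪' v).U n ↔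
      (σ : absoluteGaloisGroup K) ∈ (absRestrictNormalHom (rayClassField K 𝔪')).ker ∧
      Valued.v ((((rayAdicCharacter h𝔪 hv hw σ : (v.adicCompletionIntegers K)ˣ) :
        v.adicCompletionIntegers K) : v.adicCompletion K) - 1) ≤ WithZero.exp (-((n + 1 : ℕ) : ℤ)) := by
  constructor
  · intro h
    have hσ := mem_ker_of_mem_rayAdicTower_U h𝔪' v h
    refine ⟨hσ, ?_⟩
    have h' := (mem_rayAdicTower_iff_valued' h𝔪' hw hle hv' n σ hσ).mp h
    rwa [← rayAdicCharacter_eq_of_le h𝔪 hv hw h𝔪' hle hv' (units_eq_one_of_sub_one_mem_of_le hle hw)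
      ⟨σ, hσ⟩] at h'
  · rintro ⟨hσ, h⟩
    rw [mem_rayAdicTower_iff_valued' h𝔪' hw hle hv' n σ hσ,
      ← rayAdicCharacter_eq_of_le h𝔪 hv hw h𝔪' hle hv' (units_eq_one_of_sub_one_mem_of_le hle hw) ⟨σ, hσ⟩]
    exact h

variable {p : ℕ} [Fact p.Prime] (e : v.adicCompletionIntegers K ≃+* ℤ_[p])

/-- The value of `κ_p = e ∘ κ : Gal(K̄/K(𝔪)) →* ℤ_pˣ` in `ℤ_p`. [cite: deShalit1987, I.3.3 (9) (p. 18)] -/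
theorem coe_padicRayAdicCharacter_apply (σ : ↥(absRestrictNormalHom (rayClassField K 𝔪)).ker) :
    (((Units.map (e : v.adicCompletionIntegers K →+* ℤ_[p]).toMonoidHom).comp
        (rayAdicCharacter h𝔪 hv hw) σ : ℤ_[p]ˣ) : ℤ_[p]) =
      e (rayAdicCharacter h𝔪 hv hw σ : v.adicCompletionIntegers K) := rfl

/-- ★★★ **`hU` VERBATIM for `(rayAdicTower, κ_p)`**: `σ ∈ U_n ↔ σ ∈ U_0 ∧ κ_p σ ≡ 1 mod p^{n+1}` — the
hypothesis `hU` of `SubgroupTower.exists_cellMap_of_character` / `cellMap_injective` /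
`cellMap_fiberSurj` / `GroupDistribution.comap_family_equivariant_of_character` and of the series
families of `PAdicOneVariableSeriesFamilyOfCharacter.lean`, for the GLOBAL ray class tower
`Gal(K̄/K(𝔪'v^{n+1})) ≤ Gal(K̄/K(𝔪))`, `𝔪 ∣ 𝔪'`, with the ONE character `κ_p = e ∘ κ` above `𝔪`
(de Shalit II.1.9 / II.4.6: `Gal(K(𝔣𝔭^{n+1})/K(𝔣𝔭)) ≅ (1 + 𝔭𝒪_𝔭)/(1 + 𝔭^{n+1}𝒪_𝔭)`).
[cite: deShalit1987, II.1.9 (p. 43), II.4.6 (p. 59), I.3.3 (9) (p. 18)] -/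
theorem mem_rayAdicTower_iff (hle : 𝔪' ≤ 𝔪) (hv' : ¬ 𝔪' ≤ v.asIdeal) (n : ℕ) (σ : ↥(absRestrictNormalHom (rayClassField K 𝔪)).ker) :
    σ ∈ (rayAdicTower (𝔪 := 𝔪) h𝔪' v).U n ↔ σ ∈ (rayAdicTower (𝔪 := 𝔪) h𝔪' v).U 0 ∧
      PadicInt.toZModPow (n + 1)
        (((Units.map (e : v.adicCompletionIntegers K →+* ℤ_[p]).toMonoidHom).comp
          (rayAdicCharacter h𝔪 hv hw) σ : ℤ_[p]ˣ) : ℤ_[p]) = 1 := by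
  rw [mem_rayAdicTower_iff_valued h𝔪' h𝔪 hv hw hle hv', mem_rayAdicTower_iff_valued h𝔪' h𝔪 hv hw hle hv',
    coe_padicRayAdicCharacter_apply, toZModPow_map_eq_one_iff_valued]
  refine ⟨fun h ↦ ⟨⟨h.1, h.2.trans ?_⟩, h.2⟩, fun h ↦ ⟨h.1.1, h.2⟩⟩
  rw [WithZero.exp_le_exp]
  push_cast
  omega

/-- ★★★ **`hκ` VERBATIM for `(rayAdicTower, κ_p)`** (from de Shalit's (9) above `𝔪'`: `κ` maps
`Gal(K̄/K(𝔪'))` ONTO `𝒪_vˣ`): every `u ∈ ℤ_pˣ` with `u ≡ 1 mod p` is `≡ κ_p σ mod p^{n+1}` for some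
`σ ∈ U_0` — the hypothesis `hκ` of `SubgroupTower.cellMap_fiberSurj` / `exists_cell_cellMap_eq`.
[cite: deShalit1987, I.3.3 (9) (p. 18), II.1.9 (p. 43)] -/
theorem exists_toZModPow_padicRayAdicCharacter_eq (hle : 𝔪' ≤ 𝔪) (hv' : ¬ 𝔪' ≤ v.asIdeal) (n : ℕ) (u : ℤ_[p]ˣ)
    (hu : PadicInt.toZModPow 1 (u : ℤ_[p]) = 1) :
    ∃ σ ∈ (rayAdicTower (𝔪 := 𝔪) h𝔪' v).U 0, PadicInt.toZModPow (n + 1)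
        (((Units.map (e : v.adicCompletionIntegers K →+* ℤ_[p]).toMonoidHom).comp
          (rayAdicCharacter h𝔪 hv hw) σ : ℤ_[p]ˣ) : ℤ_[p]) = PadicInt.toZModPow (n + 1) (u : ℤ_[p]) := by
  have hw' := units_eq_one_of_sub_one_mem_of_le hle hw
  obtain ⟨τ, hτ⟩ := rayAdicCharacter_surjective h𝔪' hv' hw'
    (Units.map (e.symm : ℤ_[p] →+* v.adicCompletionIntegers K).toMonoidHom u)
  set σ : ↥(absRestrictNormalHom (rayClassField K 𝔪)).ker :=
    ⟨τ, ker_absRestrictNormalHom_rayClassField_anti h𝔪' hle τ.2⟩ with hσ_def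
  have hστ : rayAdicCharacter h𝔪 hv hw σ = rayAdicCharacter h𝔪' hv' hw' τ :=
    rayAdicCharacter_eq_of_le h𝔪 hv hw h𝔪' hle hv' hw' τ
  have hval : (((Units.map (e : v.adicCompletionIntegers K →+* ℤ_[p]).toMonoidHom).comp
      (rayAdicCharacter h𝔪 hv hw) σ : ℤ_[p]ˣ) : ℤ_[p]) = u := by
    rw [coe_padicRayAdicCharacter_apply, hστ, hτ, Units.coe_map, RingHom.toMonoidHom_eq_coe,
      MonoidHom.coe_coe, RingHom.coe_coe, RingEquiv.apply_symm_apply]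
  refine ⟨σ, ?_, by rw [hval]⟩
  rw [mem_rayAdicTower_iff h𝔪' h𝔪 hv hw e hle hv' 0 σ]
  -- both conjuncts say `κ_p σ ≡ 1 mod p` (and `σ ∈ Gal(K̄/K(𝔪'))`)
  have h1 : PadicInt.toZModPow (0 + 1)
      (((Units.map (e : v.adicCompletionIntegers K →+* ℤ_[p]).toMonoidHom).comp
        (rayAdicCharacter h𝔪 hv hw) σ : ℤ_[p]ˣ) : ℤ_[p]) = 1 := by
    rw [hval]; exact hu
  refine ⟨?_, h1⟩
  rw [mem_rayAdicTower_iff_valued h𝔪' h𝔪 hv hw hle hv', ← toZModPow_map_eq_one_iff_valued e,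
    ← coe_padicRayAdicCharacter_apply h𝔪 hv hw e]
  exact ⟨τ.2, h1⟩

/-- **The strong form**: `κ_p` is onto `ℤ_pˣ`. [cite: deShalit1987, I.3.3 (9) (p. 18)] -/
theorem padicRayAdicCharacter_surjective :
    Function.Surjective ((Units.map (e : v.adicCompletionIntegers K →+* ℤ_[p]).toMonoidHom).comp
      (rayAdicCharacter h𝔪 hv hw)) := by
  intro u
  obtain ⟨σ, hσ⟩ := rayAdicCharacter_surjective h𝔪 hv hw
    (Units.map (e.symm : ℤ_[p] →+* v.adicCompletionIntegers K).toMonoidHom u)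
  refine ⟨σ, Units.ext ?_⟩
  rw [coe_padicRayAdicCharacter_apply, hσ, Units.coe_map, RingHom.toMonoidHom_eq_coe,
    MonoidHom.coe_coe, RingHom.coe_coe, RingEquiv.apply_symm_apply]

end Tower

end Literature.NumberTheory.NumberFields

end
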